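import Summits.QuantumFields.YangMills.Theses.UnitScaleTilt

/-!
# OPTIONAL fallback re-cut certified: COFINAL tilt comparison + ONE-PROFILE history tail ⇒ leaf

crux-ideate 2/2 (ideator `ym-cruxidea-18916-2`, gen 3, lens NEGATION), 2026-08-27.  Companion of `MonoLift.lean`
(`historyTailL_iff_oneProfile`).  Because the history tail is MONOTONE UPWARD in the profile, the deciding theorem does not
need the tilt-side comparison at EVERY profile beyond thresholds (`FluctuationComparisonRegPrL`: `∃ (b₁,p₁) ∀ (b₀,p₀) ⪰ …`) — a
COFINAL family of served profiles suffices: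

  `FluctuationComparisonRegPrCofinal : ∀ L (b₁ p₁ : ℝ), ∃ (b₀,p₀), b₁ ≤ b₀ ∧ p₁ ≤ p₀ ∧ 0 < b₀ ∧ 2 < p₀ ∧ ∃ ε₁ > 0, ∀ ε₀ ∈ (0,ε₁], ∃ m₀, ∀ m ≥ m₀, ∃ γ₁ > 0, ∀ F γ …, FluctuationComparisonRegPrAt F γ b₀ p₀ m ε₀`

(WEAKER than `FluctuationComparisonRegPrL`: `fcCofinal_of_L` below), together with `HistoryTailOneProfile` (⇔ `HistoryTailL`).
`closes_cofinal` is `closes` (rev ≥ 7) with the order of choices: history's native profile `(bh,ph)` FIRST, then the tilt side's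
served profile `(b₀,p₀) ⪰ (bh,ph)`, then the history tail is moved up to `(b₀,p₀)` by `historyTailAt_mono` (the refined coupling is `≤ 1`).
USE: only if the lane's exact-profile record clause (`AlphaInputsT3ACv2Rec`: «∀ (b₀,p₀) ⪰ thresholds ∃ 𝔠, 𝔠.b₀ = b₀ ∧ 𝔠.p₀ = p₀») turns
out undischargeable (F-owner-g17-1: records reach `p₀ = 2r₀+1`, `b₀ = b₀(𝔠)` only) — then «∀ b₁ p₁ ∃ 𝔠, b₁ ≤ 𝔠.b₀ ∧ p₁ ≤ 𝔠.p₀ ∧ …»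
(records along ANY cofinal family, e.g. `r₀ ∈ ℕ`) is all the route needs.  Count-neutral; nothing here is an estimate.
-/

namespace Summit.QuantumFields.YangMills.Cruxes.HistoryTailL.Ideas18916i2Cofinal

open MeasureTheory Filter Topology
open Literature.MathematicalPhysics.QuantumFieldTheory.Balaban1983to89
open Literature.MathematicalPhysics.QuantumFieldTheory.Balaban1983to89.T3ContinuumYM3Torus
open Literature.MathematicalPhysics.QuantumFieldTheory.Balaban1983to89.T3UnitLawDensityEML (ℰp)
open Summit.QuantumFields.YangMills.Theses.UnitScaleTilt

/-! ## §0 The monotone lift (as in `MonoLift.lean`, repeated so that this file stands alone) -/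

theorem pFun_mono {b₀ b₀' p₀ p₀' g : ℝ} (hb : 0 ≤ b₀) (hbb : b₀ ≤ b₀') (hpp : p₀ ≤ p₀') (hg : 0 < g) (hg1 : g ≤ 1) :
    B10.pFun b₀ p₀ g ≤ B10.pFun b₀' p₀' g := by
  unfold B10.pFun
  have hlog : 0 ≤ Real.log g⁻¹ := by
    rw [Real.log_inv]; have := Real.log_nonpos hg.le hg1; linarith
  have ht : (1 : ℝ) ≤ 1 + Real.log g⁻¹ := by linarith
  have h1 : (1 + Real.log g⁻¹) ^ p₀ ≤ (1 + Real.log g⁻¹) ^ p₀' := Real.rpow_le_rpow_of_exponent_le ht hpp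
  have h2 : 0 ≤ (1 + Real.log g⁻¹) ^ p₀' := Real.rpow_nonneg (by linarith) _
  calc b₀ * (1 + Real.log g⁻¹) ^ p₀ ≤ b₀ * (1 + Real.log g⁻¹) ^ p₀' := mul_le_mul_of_nonneg_left h1 hb
    _ ≤ b₀' * (1 + Real.log g⁻¹) ^ p₀' := mul_le_mul_of_nonneg_right hbb h2

theorem θBal_mono {L : ℕ} (hL : 1 ≤ L) {γ b₀ b₀' p₀ p₀' : ℝ} (hγ : 0 < γ) (hγ1 : γ ≤ 1)
    (hb : 0 ≤ b₀) (hbb : b₀ ≤ b₀') (hpp : p₀ ≤ p₀') (i : ℕ) :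
    T3UnitScaleTilt.θBal L γ b₀ p₀ i ≤ T3UnitScaleTilt.θBal L γ b₀' p₀' i := by
  unfold T3UnitScaleTilt.θBal
  have hL' : (1 : ℝ) ≤ L := by exact_mod_cast hL
  have hLi : 0 < ((L : ℝ)⁻¹) ^ i := pow_pos (inv_pos.mpr (by linarith)) i
  have hLi1 : ((L : ℝ)⁻¹) ^ i ≤ 1 := pow_le_one₀ (inv_nonneg.mpr (by linarith)) (inv_le_one_of_one_le₀ hL')
  have h0 : 0 < Real.sqrt (γ * ((L : ℝ)⁻¹) ^ i) := Real.sqrt_pos.mpr (mul_pos hγ hLi)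
  have h1 : Real.sqrt (γ * ((L : ℝ)⁻¹) ^ i) ≤ 1 := Real.sqrt_le_one.mpr
    (calc γ * ((L : ℝ)⁻¹) ^ i ≤ 1 * 1 := mul_le_mul hγ1 hLi1 hLi.le zero_le_one
      _ = 1 := one_mul 1)
  exact mul_le_mul_of_nonneg_left (pFun_mono hb hbb hpp h0 h1) h0.le

theorem historyTailAt_mono (F : T3Family) {γ b₀ b₀' p₀ p₀' : ℝ} {m : ℕ} (hγ : 0 < γ) (hγ1 : γ ≤ 1)
    (hb : 0 ≤ b₀) (hbb : b₀ ≤ b₀') (hpp : p₀ ≤ p₀')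
    (h : T3UnitScaleTilt.HistoryTailAt F γ b₀ p₀ m) : T3UnitScaleTilt.HistoryTailAt F γ b₀' p₀' m := by
  obtain ⟨w, hw, hK⟩ := h
  have hθ := θBal_mono F.hL.2.le hγ hγ1 hb hbb hpp
  have hsub : ∀ K n,
      (T3UnitScaleTilt.histGood F ℰp (T3UnitScaleTilt.θBal F.L γ b₀' p₀') K n)ᶜ ⊆
        (T3UnitScaleTilt.histGood F ℰp (T3UnitScaleTilt.θBal F.L γ b₀ p₀) K n)ᶜ := fun K n =>
    Set.compl_subset_compl.mpr fun U hU j hj p => lt_of_lt_of_le (hU j hj p) (hθ _)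
  refine ⟨w, hw, fun K => ?_⟩
  haveI := T3UnitScaleTilt.isProbabilityMeasure_gibbsK F ℰp hγ.le K
  haveI := T3UnitScaleTilt.isProbabilityMeasure_gibbsK F ℰp hγ.le (K + 1)
  exact ⟨(measureReal_mono (hsub K _)).trans (hK K).1, (measureReal_mono (hsub (K + 1) _)).trans (hK K).2⟩

/-! ## §1 The two texts of the fallback cut -/

/-- History side: ONE profile per `L` before `m` (⇔ `HistoryTailL`, `MonoLift.lean`). -/
def HistoryTailOneProfile : Prop :=
  ∀ (L : ℕ), ∃ (b₀ p₀ : ℝ), 0 < b₀ ∧ 2 < p₀ ∧ ∀ (m : ℕ), 0 < m → ∃ γ₁ : ℝ, 0 < γ₁ ∧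
    ∀ (F : T3Family) (γ : ℝ), F.L = L → 0 < γ → γ ≤ γ₁ → T3UnitScaleTilt.HistoryTailAt F γ b₀ p₀ m

/-- Tilt side, COFINAL form: beyond every pair of thresholds SOME profile is served (weaker than `FluctuationComparisonRegPrL`). -/
def FluctuationComparisonRegPrCofinal : Prop :=
  ∀ (L : ℕ) (b₁ p₁ : ℝ), ∃ (b₀ p₀ : ℝ), b₁ ≤ b₀ ∧ p₁ ≤ p₀ ∧ 0 < b₀ ∧ 2 < p₀ ∧ ∃ ε₁ : ℝ, 0 < ε₁ ∧
    ∀ (ε₀ : ℝ), 0 < ε₀ → ε₀ ≤ ε₁ → ∃ m₀ : ℕ, ∀ (m : ℕ), m₀ ≤ m → ∃ γ₁ : ℝ, 0 < γ₁ ∧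
      ∀ (F : T3Family) (γ : ℝ), F.L = L → 0 < γ → γ ≤ γ₁ → T3PrintedRegularMinimiser.FluctuationComparisonRegPrAt F γ b₀ p₀ m ε₀

/-- The route's tilt crux implies the cofinal form (profile `(max b₁ b₁' , max (max p₁ p₁') 3)`, say). -/
theorem fcCofinal_of_L (h : FluctuationComparisonRegPrL) : FluctuationComparisonRegPrCofinal := by
  intro L b₁ p₁
  obtain ⟨b₁', p₁', hB⟩ := h L
  refine ⟨max (max b₁ b₁') 1, max (max p₁ p₁') 3, (le_max_left _ _).trans (le_max_left _ _),
    (le_max_left _ _).trans (le_max_left _ _), lt_of_lt_of_le one_pos (le_max_right _ _),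
    lt_of_lt_of_le (by norm_num) (le_max_right _ _), ?_⟩
  exact hB _ _ ((le_max_right _ _).trans (le_max_left _ _)) ((le_max_right _ _).trans (le_max_left _ _))
    (lt_of_lt_of_le one_pos (le_max_right _ _)) (lt_of_lt_of_le (by norm_num) (le_max_right _ _))

/-! ## §2 The deciding theorem of the fallback cut -/

/-- **`closes_cofinal`**: `MinimiserStabilityRegPr ∧ FluctuationComparisonRegPrCofinal ∧ HistoryTailOneProfile ⇒ YM3TorusSU2`. -/
theorem closes_cofinal (h200 : MinimiserStabilityRegPr) (h201 : FluctuationComparisonRegPrCofinal)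
    (hK2 : HistoryTailOneProfile) :
    Literature.MathematicalPhysics.QuantumFieldTheory.Balaban1983to89.T3YM3TorusStatement.YM3TorusSU2 := by
  refine ⟨1, one_pos, fun F γ hγ _ => ?_⟩
  obtain ⟨bh, ph, hbh, hph, hT⟩ := hK2 F.L
  obtain ⟨b₀, p₀, hb₁, hp₁, hb₀, hp₀, ε₁', hε₁', hB'⟩ := h201 F.L bh ph
  obtain ⟨ε₁, hε₁, hA⟩ := h200 F.L
  obtain ⟨m₁, hm₁⟩ := hA (min ε₁ ε₁') (lt_min hε₁ hε₁') (min_le_left _ _)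
  obtain ⟨m₂, hm₂⟩ := hB' (min ε₁ ε₁') (lt_min hε₁ hε₁') (min_le_right _ _)
  obtain ⟨γ₂, hγ₂, hT'⟩ := hT (max (max m₁ m₂) 1) (lt_of_lt_of_le Nat.one_pos (le_max_right _ _))
  obtain ⟨γ₃, hγ₃, hA'⟩ := hm₁ (max (max m₁ m₂) 1) ((le_max_left _ _).trans (le_max_left _ _)) b₀ p₀ hb₀ hp₀
  obtain ⟨γ₄, hγ₄, hB''⟩ := hm₂ (max (max m₁ m₂) 1) ((le_max_right _ _).trans (le_max_left _ _))
  have hL : (1 : ℝ) < F.L := by exact_mod_cast F.hL.2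
  have hL0 : (0 : ℝ) < F.L := zero_lt_one.trans hL
  obtain ⟨n, hn⟩ := ((tendsto_pow_atTop_nhds_zero_of_lt_one (inv_nonneg.mpr hL0.le)
    (inv_lt_one_of_one_lt₀ hL)).eventually
      (ge_mem_nhds (div_pos (lt_min (lt_min hγ₂ one_pos) (lt_min hγ₃ hγ₄)) hγ))).exists
  have hpos : 0 < γ * ((F.L : ℝ)⁻¹) ^ n := mul_pos hγ (pow_pos (inv_pos.mpr hL0) n)
  have hle : γ * ((F.L : ℝ)⁻¹) ^ n ≤ min (min γ₂ 1) (min γ₃ γ₄) := by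
    have e := mul_le_mul_of_nonneg_left hn hγ.le
    rwa [mul_div_cancel₀ _ hγ.ne'] at e
  have hT'' : T3UnitScaleTilt.HistoryTailAt (F.refine n) (γ * ((F.L : ℝ)⁻¹) ^ n) b₀ p₀ (max (max m₁ m₂) 1) :=
    historyTailAt_mono (F.refine n) hpos ((hle.trans (min_le_left _ _)).trans (min_le_right _ _)) hbh.le hb₁ hp₁
      (hT' (F.refine n) _ rfl hpos ((hle.trans (min_le_left _ _)).trans (min_le_left _ _)))
  exact Literature.MathematicalPhysics.QuantumFieldTheory.Balaban1983to89.T3UnitScaleTilt.continuumYM3Torus_of_unitTiltAt_historyTailAt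
    F hγ.le n
    (Literature.MathematicalPhysics.QuantumFieldTheory.Balaban1983to89.T3PrintedRegularMinimiser.heightSandwich_unitTilt_of_regPr
      hpos.le
      (hA' (F.refine n) _ rfl hpos (hle.trans ((min_le_right _ _).trans (min_le_left _ _))))
      (hB'' (F.refine n) _ rfl hpos (hle.trans ((min_le_right _ _).trans (min_le_right _ _))))).2
    hT''

/-- Sanity: the route's CURRENT cone implies the fallback cone (so the fallback is count-neutral and never harder). -/
theorem closes_of_current (h200 : MinimiserStabilityRegPr) (h201 : FluctuationComparisonRegPrL) (hK2 : HistoryTailL) :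
    Literature.MathematicalPhysics.QuantumFieldTheory.Balaban1983to89.T3YM3TorusStatement.YM3TorusSU2 :=
  closes_cofinal h200 (fcCofinal_of_L h201) fun L => by
    obtain ⟨b₀, p₀, -, -, hb, hp, hT⟩ := hK2 L 0 0
    exact ⟨b₀, p₀, hb, hp, hT⟩

end Summit.QuantumFields.YangMills.Cruxes.HistoryTailL.Ideas18916i2Cofinal
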